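import Literature.AlgebraicGeometry.ModuliOfAbelianVarieties.SiegelReindexTower
import Literature.AlgebraicGeometry.Motives.AbelianVarietyWeilPairingSimilitudeTowers
import Literature.AlgebraicGeometry.Motives.AbelianVarietyWeilPairingAlgClosure
import Literature.AlgebraicGeometry.Motives.AbelianVarietyWeilPairingConjugate
import Literature.AlgebraicGeometry.ModuliOfAbelianVarieties.SiegelAdelicMarkingConjugateTransport
import HarnessLib

/-!
# Tower proportionality on the `σ`-re-base: the Weil pairings of `Θσ` and `h^*Θ₂` on `Bσ[M]` differ by a unit exponent
# ([Milne 2005] §6 p. 75 «`ψ_N` corresponds to a `(ℤ/Nℤ)^×`-multiple of `e_N`», Thm. 6.11 p. 74; [Lan 2013] §1.3.6; [Deligne 1971] 4.16)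

Topic `AlgebraicGeometry/ModuliOfAbelianVarieties`; namespace `Literature.AlgebraicGeometry.ModuliOfAbelianVarieties.SiegelAdelicMarking`.
Cell hodgecm-mathlib (D-0151), rung-0 (P)-layer skeleton `M1primeOfFU`, stub W3, hypothesis H3 `TripleTransportAlongId`,
**(λ-T) = the `htower` input of the λ-clause (c-iii)** (B-plan1 P41 (3), 2026-08-29T01:36:02Z; finding B-p21 01:35:25Z, repair
(R-a) `hpair`).  THEOREMS ONLY (no definition, no named fact, no instance, no `sorry`); every input BY NAME:
★ `SiegelReindexTower.reindexTowerOf` / `adelicCongr_inv_reindex_of_adelicCongr_mul_inv` (B-p15: `κ_M = k mod M` is a similitude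
of `E_δ mod M` with unit multiplier, and `(bk)⁻¹v̂ ≡ x/M ⇒ b⁻¹v̂ ≡ κ_M x/M`), ★ R60-58 `exists_adelicCongr_left/right` (totality),
★ (S1) `AbelianVariety.exists_isCoprime_weilPairingLevel_pullback_eq_zpow` (B-p03), ★ `conjPoints_mem_torsionPoints`,
★ `map_mem_torsionPoints`, ★ `isDominant_toSchemeHom_iso_hom` / `isDominant_toSchemeHom_zsmul_of_ne_zero`.
HC_CM is proved only modulo the 7 printed citations until rung 0 closes.

## Setting (H3's binders, wlayer v14 :6439 + the P41 clause `hpair`)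
Two fibres `B₁ = A₁(s₁)`, `B₂ = A₂(s₂)` of abelian schemes with level-`N` structures `φ₁, φ₂`, symplectic-lift towers
`Λ₁` (for `Θ₁`), `Λ₂` (for `Θ₂`) read through the markings `m₁` by `[J, a]`, `m₂` by `[J′, a′]` (the `MarkedBy` tower clauses);
`σ ∈ Aut(ℂ/ℚ)`, `k ∈ K_δ(N)`, the transferred `f_B : B₁^σ ⟶ B₂` with the ★ `IsModuli` clause («`f_B((u₁ v)^σ) = u₂ w` whenever
`k a⁻¹ v̂ ≡ a′⁻¹ ŵ`»); an abelian variety `Bσ` (the fibre of the `σ`-re-base) with `jσ : Bσ ≅ B₁^σ` and a divisor `Θσ` whose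
level-`M` Weil pairings READ `σ ∘ ē^{Θ₁}` through `jσ⁻¹ ∘ (·)^σ` (the clause `hpair`); `h : Bσ ≅ B₂` with `h = jσ ≫ f_B`.

## What is proved
* §1 `map_conjPoints_lift_eq_lift_reindex_mulVec` — **`f_B((Λ₁ x)^σ) = Λ₂(κ_M x)`** for every level `N ∣ M ≠ 0` and
  `x ∈ (ℤ/M)^{2g}`: the transferred map carries the `σ`-conjugate of the first tower to the second tower RE-INDEXED by
  `κ_M = k mod M` (totality of `AdelicCongr` + the two tower clauses + ★ `adelicCongr_inv_reindex_of_adelicCongr_mul_inv`).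
* §2 **`exists_isCoprime_weilPairingLevel_pullback_eq_zpow_rebase`** — for every level `N ∣ M`, `(M : ℂ) ≠ 0`:
  `ē^{h^*Θ₂}_M = (ē^{Θσ}_M)^a` on `Bσ[M](ℂ)` for some `a` coprime to `M` (★ (S1) with the basis
  `x ↦ jσ⁻¹((Λ₁ x)^σ)` of `Bσ[M]` — a `Θσ`-similitude with root `σ(ζ₁)` by `hpair` + `Λ₁.pairing` — carried by `h` to
  `Λ₂ ∘ κ_M`, a similitude-translate of the `Θ₂`-similitude basis `Λ₂`), and the inverted reading
  **`exists_isCoprime_weilPairingLevel_eq_pullback_zpow_rebase`**: `ē^{Θσ}_M = (ē^{h^*Θ₂}_M)^b`, `b` coprime to `M` (values in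
  `μ_M`, ★ `weilPairingLevel_pow_card_eq_one`) — the `htower` input of ★ B-p03 `AbelianVarietyPolarisationRigidity` at
  `Θ₂ := Θσ`, `Θ₁ := h^*Θ₂`.

## References
* [Milne2005ShimuraVarieties] J. S. Milne, *Introduction to Shimura varieties* (2005; 2017 revision), §6 Thm. 6.11 p. 74 and
  p. 75; §14 pp. 124–125.
* [Lan2013PELCompactifications] K.-W. Lan, *Arithmetic compactifications of PEL-type Shimura varieties* (2013), §1.3.6
  Def. 1.3.6.1–1.3.6.2 (pp. 79–80), Lemma 1.3.6.5 (p. 81).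
* [Deligne1971TravauxShimura] P. Deligne, *Travaux de Shimura*, Sém. Bourbaki 389 (1971), 4.12 (b) p. 149, 4.16 p. 150.
-/

set_option autoImplicit false

noncomputable section

open CategoryTheory AlgebraicGeometry
open scoped Matrix
open Literature.AlgebraicGeometry.Motives (AbelianVariety AlgPoints CartierDivisor)
open Literature.AlgebraicGeometry.Motives.AbelianVariety (isDominant_toSchemeHom_zsmul_of_ne_zero
  isDominant_toSchemeHom_iso_hom map_mem_torsionPoints)
open Literature.AlgebraicGeometry.AbelianSchemes (AbelianSchemeOver)

namespace Literature.AlgebraicGeometry.ModuliOfAbelianVarieties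

namespace SiegelAdelicMarking

variable {g N : ℕ} {δ : Fin g → ℕ} {J J' : C0pm δ} {a a' k : gspFinAdelic δ}
variable {S₁ : Scheme} {A₁ : AbelianSchemeOver S₁} {s₁ : Spec (.of ℂ) ⟶ S₁} {φ₁ : A₁.LevelStructure g N}
  {Θ₁ : CartierDivisor (A₁.fibre s₁).toAbelianVariety.X.left}
variable {S₂ : Scheme} {A₂ : AbelianSchemeOver S₂} {s₂ : Spec (.of ℂ) ⟶ S₂} {φ₂ : A₂.LevelStructure g N}
  {Θ₂ : CartierDivisor (A₂.fibre s₂).toAbelianVariety.X.left}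

/-! ### §0. Exponent bookkeeping in `μ_M` -/

/-- If `a` is coprime to `M`, some `b` coprime to `M` inverts `x ↦ x ^ a` on the `M`-th roots of unity of a field.
[cite: Lang1983AbelianVarieties, Ch. VII §2 Prop. 3] -/
theorem exists_isCoprime_forall_eq_zpow_zpow {K : Type*} [Field K] {M : ℕ} {a : ℤ} (ha : IsCoprime a M) :
    ∃ b : ℤ, IsCoprime b (M : ℤ) ∧ ∀ x : K, x ≠ 0 → x ^ M = 1 → x = (x ^ a) ^ b := by
  obtain ⟨u, v, huv⟩ := ha
  refine ⟨u, ⟨a, v, by linear_combination huv⟩, fun x hx hxM => ?_⟩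
  have hau : a * u = 1 - (M : ℤ) * v := by linear_combination huv
  rw [← zpow_mul, hau, zpow_sub₀ hx, zpow_one, zpow_mul, zpow_natCast, hxM, one_zpow, div_one]

/-! ### §1. The transferred map carries the conjugate first tower to the re-indexed second tower -/

/-- **`f_B((Λ₁ x)^σ) = Λ₂(κ_M x)`.**  For a level `N ∣ M ≠ 0` and `x ∈ (ℤ/M)^{2g}`: pick `v` with `a⁻¹ v̂ ≡ x/M` (totality,
★ `exists_adelicCongr_left`), so `Λ₁ x = u₁ v` (first tower clause); pick a partner `w` with `k a⁻¹ v̂ ≡ a′⁻¹ ŵ`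
(★ `exists_adelicCongr_right`), so `f_B((u₁ v)^σ) = u₂ w`; and `a′⁻¹ ŵ ≡ k a⁻¹ v̂ ≡ κ_M x/M`
(★ `adelicCongr_inv_reindex_of_adelicCongr_mul_inv` with `b = a k⁻¹`), so `u₂ w = Λ₂(κ_M x)` (second tower clause).
[cite: Milne2005ShimuraVarieties, §6 Thm. 6.11 p. 74 and p. 75] [cite: Deligne1971TravauxShimura, 4.16 p. 150] -/
theorem map_conjPoints_lift_eq_lift_reindex_mulVec (hN : N ≠ 0) (σ : ℂ ≃+* ℂ)
    (hk : k ∈ principalLevelSubgroup δ N)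
    (Λ₁ : φ₁.SymplecticLift s₁ Θ₁ δ) (m₁ : SiegelAdelicMarking J a (A₁.fibre s₁).toAbelianVariety)
    (hΛ₁ : ∀ ⦃M : ℕ⦄, N ∣ M → M ≠ 0 → ∀ (x : Fin g ⊕ Fin g → ZMod M) (v : Fin g ⊕ Fin g → ℚ),
      AdelicCongr ((a⁻¹ : gspFinAdelic δ) : GL (Fin g ⊕ Fin g) finAdeleQ) 1 v (fun i => ((x i).val : ℚ) / M) →
        ((Λ₁.lift M (Multiplicative.ofAdd x)) : (A₁.fibre s₁).toAbelianVariety.Points ℂ) = m₁.r v)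
    (Λ₂ : φ₂.SymplecticLift s₂ Θ₂ δ) (m₂ : SiegelAdelicMarking J' a' (A₂.fibre s₂).toAbelianVariety)
    (hΛ₂ : ∀ ⦃M : ℕ⦄, N ∣ M → M ≠ 0 → ∀ (x : Fin g ⊕ Fin g → ZMod M) (v : Fin g ⊕ Fin g → ℚ),
      AdelicCongr ((a'⁻¹ : gspFinAdelic δ) : GL (Fin g ⊕ Fin g) finAdeleQ) 1 v (fun i => ((x i).val : ℚ) / M) →
        ((Λ₂.lift M (Multiplicative.ofAdd x)) : (A₂.fibre s₂).toAbelianVariety.Points ℂ) = m₂.r v)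
    (f_B : ((A₁.fibre s₁).toAbelianVariety).conjugate σ ⟶ (A₂.fibre s₂).toAbelianVariety)
    (hf : ∀ v w : Fin g ⊕ Fin g → ℚ,
      AdelicCongr ((k * a⁻¹ : gspFinAdelic δ) : GL (Fin g ⊕ Fin g) finAdeleQ)
          ((a'⁻¹ : gspFinAdelic δ) : GL (Fin g ⊕ Fin g) finAdeleQ) v w →
        AlgPoints.map f_B.hom.hom.hom
          (((A₁.fibre s₁).toAbelianVariety).conjPoints σ (m₁.r v)) = m₂.r w)
    ⦃M : ℕ⦄ (hNM : N ∣ M) (hM₀ : M ≠ 0) (x : Fin g ⊕ Fin g → ZMod M) :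
    AlgPoints.map f_B.hom.hom.hom (((A₁.fibre s₁).toAbelianVariety).conjPoints σ
        ((Λ₁.lift M (Multiplicative.ofAdd x)) : (A₁.fibre s₁).toAbelianVariety.Points ℂ)) =
      ((Λ₂.lift M (Multiplicative.ofAdd ((reindexTowerOf hN hk).κ M *ᵥ x))) :
        (A₂.fibre s₂).toAbelianVariety.Points ℂ) := by
  -- `v` with `a⁻¹ v̂ ≡ x/M`, and a partner `w` with `k a⁻¹ v̂ ≡ a′⁻¹ ŵ`
  obtain ⟨v, hv⟩ := exists_adelicCongr_left ((a⁻¹ : gspFinAdelic δ) : GL (Fin g ⊕ Fin g) finAdeleQ) 1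
    (fun i => ((x i).val : ℚ) / M)
  obtain ⟨w, hvw⟩ := exists_adelicCongr_right ((k * a⁻¹ : gspFinAdelic δ) : GL (Fin g ⊕ Fin g) finAdeleQ)
    ((a'⁻¹ : gspFinAdelic δ) : GL (Fin g ⊕ Fin g) finAdeleQ) v
  -- `k a⁻¹ v̂ ≡ κ_M x / M`
  have hb : a * k⁻¹ * k = a := inv_mul_cancel_right a k
  have hb' : (a * k⁻¹)⁻¹ = k * a⁻¹ := by rw [mul_inv_rev, inv_inv]
  have hv0 : AdelicCongr (((a * k⁻¹ * k)⁻¹ : gspFinAdelic δ) : GL (Fin g ⊕ Fin g) finAdeleQ) 1 v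
      (fun i => ((x i).val : ℚ) / M) := by rwa [hb]
  have hv' := adelicCongr_inv_reindex_of_adelicCongr_mul_inv hN hk hM₀ hv0
  rw [hb'] at hv'
  -- hence `a′⁻¹ ŵ ≡ κ_M x / M`
  have hw : AdelicCongr ((a'⁻¹ : gspFinAdelic δ) : GL (Fin g ⊕ Fin g) finAdeleQ) 1 w
      (fun i => ((((reindexTowerOf hN hk).κ M *ᵥ x) i).val : ℚ) / M) :=
    (adelicCongr_comm.1 hvw).trans hv'
  rw [hΛ₁ hNM hM₀ x v hv, hf v w hvw, hΛ₂ hNM hM₀ _ w hw]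

/-! ### §2. The tower proportionality on `Bσ[M]` -/

/-- **(λ-T) TOWER PROPORTIONALITY ON THE `σ`-RE-BASE.**  With the data of the module docstring, for every level `N ∣ M`,
`(M : ℂ) ≠ 0`: `ē^{h^*Θ₂}_M(P, Q) = ē^{Θσ}_M(P, Q)^a` for all `P, Q ∈ Bσ[M](ℂ)`, for some integer `a` coprime to `M`
(★ (S1) `exists_isCoprime_weilPairingLevel_pullback_eq_zpow` along `h`, for the basis `x ↦ jσ⁻¹((Λ₁ x)^σ)` of `Bσ[M]`: a
`Θσ`-similitude with root `σ(ζ₁)` by `hpair` and `Λ₁.pairing`, carried by `h = jσ ≫ f_B` to `Λ₂ ∘ κ_M` (§1), `κ_M` a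
similitude of `E_δ mod M` with unit multiplier (★ `reindexTowerOf`), `Λ₂` a `Θ₂`-similitude).
[cite: Milne2005ShimuraVarieties, §6 Thm. 6.11 p. 74 and p. 75] [cite: Lan2013PELCompactifications, §1.3.6 Lemma 1.3.6.5 (p. 81)]
[cite: Deligne1971TravauxShimura, 4.16 p. 150] -/
theorem exists_isCoprime_weilPairingLevel_pullback_eq_zpow_rebase (hN : N ≠ 0) (σ : ℂ ≃ₐ[ℚ] ℂ)
    (hk : k ∈ principalLevelSubgroup δ N)
    (Λ₁ : φ₁.SymplecticLift s₁ Θ₁ δ) (m₁ : SiegelAdelicMarking J a (A₁.fibre s₁).toAbelianVariety)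
    (hΛ₁ : ∀ ⦃M : ℕ⦄, N ∣ M → M ≠ 0 → ∀ (x : Fin g ⊕ Fin g → ZMod M) (v : Fin g ⊕ Fin g → ℚ),
      AdelicCongr ((a⁻¹ : gspFinAdelic δ) : GL (Fin g ⊕ Fin g) finAdeleQ) 1 v (fun i => ((x i).val : ℚ) / M) →
        ((Λ₁.lift M (Multiplicative.ofAdd x)) : (A₁.fibre s₁).toAbelianVariety.Points ℂ) = m₁.r v)
    (Λ₂ : φ₂.SymplecticLift s₂ Θ₂ δ) (m₂ : SiegelAdelicMarking J' a' (A₂.fibre s₂).toAbelianVariety)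
    (hΛ₂ : ∀ ⦃M : ℕ⦄, N ∣ M → M ≠ 0 → ∀ (x : Fin g ⊕ Fin g → ZMod M) (v : Fin g ⊕ Fin g → ℚ),
      AdelicCongr ((a'⁻¹ : gspFinAdelic δ) : GL (Fin g ⊕ Fin g) finAdeleQ) 1 v (fun i => ((x i).val : ℚ) / M) →
        ((Λ₂.lift M (Multiplicative.ofAdd x)) : (A₂.fibre s₂).toAbelianVariety.Points ℂ) = m₂.r v)
    {Bσ : AbelianVariety ℂ} (jσ : Bσ ≅ ((A₁.fibre s₁).toAbelianVariety).conjugate σ.toRingEquiv)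
    (Θσ : CartierDivisor Bσ.X.left)
    (hpair : ∀ ⦃M : ℕ⦄, N ∣ M → ∀ (hM : (M : ℂ) ≠ 0),
      haveI := isDominant_toSchemeHom_zsmul_of_ne_zero Bσ hM
      haveI := isDominant_toSchemeHom_zsmul_of_ne_zero (A₁.fibre s₁).toAbelianVariety hM
      ∀ (P Q : ((A₁.fibre s₁).toAbelianVariety).torsionPoints ℂ M) (Pt Qt : Bσ.torsionPoints ℂ M),
        AlgPoints.map jσ.hom.hom.hom.hom Pt.1 =
          ((A₁.fibre s₁).toAbelianVariety).conjPoints σ.toRingEquiv P.1 →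
        AlgPoints.map jσ.hom.hom.hom.hom Qt.1 =
          ((A₁.fibre s₁).toAbelianVariety).conjPoints σ.toRingEquiv Q.1 →
        Bσ.weilPairingLevel Θσ Pt Qt = σ (((A₁.fibre s₁).toAbelianVariety).weilPairingLevel Θ₁ P Q))
    (f_B : ((A₁.fibre s₁).toAbelianVariety).conjugate σ.toRingEquiv ⟶ (A₂.fibre s₂).toAbelianVariety)
    (hf : ∀ v w : Fin g ⊕ Fin g → ℚ,
      AdelicCongr ((k * a⁻¹ : gspFinAdelic δ) : GL (Fin g ⊕ Fin g) finAdeleQ)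
          ((a'⁻¹ : gspFinAdelic δ) : GL (Fin g ⊕ Fin g) finAdeleQ) v w →
        AlgPoints.map f_B.hom.hom.hom
          (((A₁.fibre s₁).toAbelianVariety).conjPoints σ.toRingEquiv (m₁.r v)) = m₂.r w)
    (h : Bσ ≅ (A₂.fibre s₂).toAbelianVariety) (hh : h.hom = jσ.hom ≫ f_B)
    ⦃M : ℕ⦄ (hNM : N ∣ M) (hM : (M : ℂ) ≠ 0) :
    haveI := isDominant_toSchemeHom_zsmul_of_ne_zero Bσ hM
    haveI := isDominant_toSchemeHom_iso_hom h
    ∃ c : ℤ, IsCoprime c (M : ℤ) ∧ ∀ P Q : Bσ.torsionPoints ℂ M,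
      Bσ.weilPairingLevel (Θ₂.pullback (AbelianVariety.Hom.toSchemeHom h.hom)) P Q =
        Bσ.weilPairingLevel Θσ P Q ^ c := by
  haveI hdσ := isDominant_toSchemeHom_zsmul_of_ne_zero Bσ hM
  haveI hd₂ := isDominant_toSchemeHom_zsmul_of_ne_zero (A₂.fibre s₂).toAbelianVariety hM
  haveI hd₁ := isDominant_toSchemeHom_zsmul_of_ne_zero (A₁.fibre s₁).toAbelianVariety hM
  haveI := isDominant_toSchemeHom_iso_hom h
  have hM₀ : M ≠ 0 := by rintro rfl; exact hM Nat.cast_zero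
  -- the unit multiplier of `κ_M` and the primitive root `σ(ζ₁)`
  obtain ⟨ν, hν⟩ := (reindexTowerOf hN hk).isUnit_u hNM hM₀
  have hζ₁ : IsPrimitiveRoot (σ (Λ₁.ζ M)) M := (Λ₁.isPrimitiveRoot_ζ hNM hM₀).map_of_injective σ.injective
  -- `jσ ∘ jσ⁻¹ = id` and `jσ⁻¹ ∘ jσ = id` on points
  have hji : ∀ y : (((A₁.fibre s₁).toAbelianVariety).conjugate σ.toRingEquiv).Points ℂ,
      AlgPoints.map jσ.hom.hom.hom.hom (AlgPoints.map jσ.inv.hom.hom.hom y) = y := fun y => by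
    rw [← AbelianVariety.map_hom_comp, Iso.inv_hom_id, AbelianVariety.map_hom_id]
  have hij : ∀ y : Bσ.Points ℂ, AlgPoints.map jσ.inv.hom.hom.hom (AlgPoints.map jσ.hom.hom.hom.hom y) = y := fun y => by
    rw [← AbelianVariety.map_hom_comp, Iso.hom_inv_id, AbelianVariety.map_hom_id]
  -- the basis `x ↦ jσ⁻¹((Λ₁ x)^σ)` of `Bσ[M]`, as an opaque function with its defining equation
  obtain ⟨LA, hLA⟩ : ∃ LA : (Fin g ⊕ Fin g → ZMod M) → Bσ.torsionPoints ℂ M, ∀ x,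
      (LA x : Bσ.Points ℂ) = AlgPoints.map jσ.inv.hom.hom.hom (((A₁.fibre s₁).toAbelianVariety).conjPoints σ.toRingEquiv
        ((Λ₁.lift M (Multiplicative.ofAdd x)) : (A₁.fibre s₁).toAbelianVariety.Points ℂ)) :=
    ⟨fun x => ⟨AlgPoints.map jσ.inv.hom.hom.hom (((A₁.fibre s₁).toAbelianVariety).conjPoints σ.toRingEquiv
        ((Λ₁.lift M (Multiplicative.ofAdd x)) : (A₁.fibre s₁).toAbelianVariety.Points ℂ)),
      map_mem_torsionPoints jσ.inv
        (((A₁.fibre s₁).toAbelianVariety).conjPoints_mem_torsionPoints σ.toRingEquiv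
          (Λ₁.lift M (Multiplicative.ofAdd x)).2)⟩, fun x => rfl⟩
  -- `jσ` reads `(·)^σ ∘ Λ₁` on the basis
  have hLAj : ∀ x, AlgPoints.map jσ.hom.hom.hom.hom (LA x : Bσ.Points ℂ) =
      ((A₁.fibre s₁).toAbelianVariety).conjPoints σ.toRingEquiv
        ((Λ₁.lift M (Multiplicative.ofAdd x)) : (A₁.fibre s₁).toAbelianVariety.Points ℂ) := fun x => by
    rw [hLA, hji]
  -- `LA` is onto `Bσ[M]`
  have hsurj : Function.Surjective LA := by
    intro T
    have hT' : AlgPoints.map jσ.hom.hom.hom.hom (T : Bσ.Points ℂ) ∈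
        (((A₁.fibre s₁).toAbelianVariety).conjugate σ.toRingEquiv).torsionPoints ℂ M :=
      map_mem_torsionPoints jσ.hom T.2
    have hSt : (((A₁.fibre s₁).toAbelianVariety).conjPoints σ.toRingEquiv).symm
        (AlgPoints.map jσ.hom.hom.hom.hom (T : Bσ.Points ℂ)) ∈ ((A₁.fibre s₁).toAbelianVariety).torsionPoints ℂ M := by
      rw [← ((A₁.fibre s₁).toAbelianVariety).conjPoints_mem_torsionPoints_iff σ.toRingEquiv, MulEquiv.apply_symm_apply]
      exact hT'
    obtain ⟨y, hy⟩ := (Λ₁.lift_bijective hNM hM₀).2 ⟨_, hSt⟩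
    refine ⟨Multiplicative.toAdd y, Subtype.ext ?_⟩
    rw [hLA, ofAdd_toAdd, hy]
    change AlgPoints.map jσ.inv.hom.hom.hom (((A₁.fibre s₁).toAbelianVariety).conjPoints σ.toRingEquiv
        ((((A₁.fibre s₁).toAbelianVariety).conjPoints σ.toRingEquiv).symm
          (AlgPoints.map jσ.hom.hom.hom.hom (T : Bσ.Points ℂ)))) = (T : Bσ.Points ℂ)
    rw [MulEquiv.apply_symm_apply, hij]
  -- `κ_M` is a similitude of `E_δ mod M` with multiplier `ν`
  have hE : ∀ x y, AbelianSchemeOver.typeFormMod δ M ((reindexTowerOf hN hk).κ M *ᵥ x)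
      ((reindexTowerOf hN hk).κ M *ᵥ y) = (ν : ZMod M) * AbelianSchemeOver.typeFormMod δ M x y := fun x y => by
    rw [hν]; exact (reindexTowerOf hN hk).κ_form hNM hM₀ x y
  -- `h = jσ ≫ f_B` carries the basis to `Λ₂ ∘ κ_M` (§1)
  have hg : ∀ x, AlgPoints.map h.hom.hom.hom.hom (LA x : Bσ.Points ℂ) =
      ((Λ₂.lift M (Multiplicative.ofAdd ((reindexTowerOf hN hk).κ M *ᵥ x))) :
        (A₂.fibre s₂).toAbelianVariety.Points ℂ) := fun x => by
    rw [hLA, hh, AbelianVariety.map_hom_comp, hji]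
    exact map_conjPoints_lift_eq_lift_reindex_mulVec hN σ.toRingEquiv hk Λ₁ m₁ hΛ₁ Λ₂ m₂ hΛ₂ f_B hf hNM hM₀ x
  -- the basis is a `Θσ`-similitude with root `σ(ζ₁)` (`hpair` + `Λ₁.pairing`)
  have hA : ∀ x y, Bσ.weilPairingLevel Θσ (LA x) (LA y) =
      σ (Λ₁.ζ M) ^ (AbelianSchemeOver.typeFormMod δ M x y).val := fun x y => by
    rw [hpair hNM hM (Λ₁.lift M (Multiplicative.ofAdd x)) (Λ₁.lift M (Multiplicative.ofAdd y)) (LA x) (LA y)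
        (hLAj x) (hLAj y), Λ₁.pairing hNM hM x y, map_pow]
  -- `Λ₂` is a `Θ₂`-similitude with root `ζ₂`
  have hB : ∀ x y, ((A₂.fibre s₂).toAbelianVariety).weilPairingLevel Θ₂ (Λ₂.lift M (Multiplicative.ofAdd x))
      (Λ₂.lift M (Multiplicative.ofAdd y)) = Λ₂.ζ M ^ (AbelianSchemeOver.typeFormMod δ M x y).val :=
    fun x y => Λ₂.pairing hNM hM x y
  exact AbelianVariety.exists_isCoprime_weilPairingLevel_pullback_eq_zpow h.hom hM₀ (AbelianSchemeOver.typeFormMod δ M)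
    Θσ Θ₂ LA hsurj (fun x => Λ₂.lift M (Multiplicative.ofAdd x)) hζ₁ (Λ₂.isPrimitiveRoot_ζ hNM hM₀)
    (fun x => (reindexTowerOf hN hk).κ M *ᵥ x) ν hE hg hA hB

/-- **(λ-T) in the consumer's direction — the `htower` input of the λ-clause**: `ē^{Θσ}_M = (ē^{h^*Θ₂}_M)^b` on `Bσ[M](ℂ)`
with `b` coprime to `M` (invert the exponent of the previous theorem inside `μ_M`, ★ `weilPairingLevel_pow_card_eq_one`).  This
is the hypothesis `htower` of ★ B-p03 `AbelianVariety.eq_of_slice_dictionary_of_weilPairingLevel_towers` at `Θ₂ := Θσ`,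
`Θ₁ := h^*Θ₂`. [cite: Milne2005ShimuraVarieties, §6 Thm. 6.11 p. 74 and p. 75, §14 pp. 124–125]
[cite: Lan2013PELCompactifications, §1.3.6 Lemma 1.3.6.5 (p. 81)] -/
theorem exists_isCoprime_weilPairingLevel_eq_pullback_zpow_rebase (hN : N ≠ 0) (σ : ℂ ≃ₐ[ℚ] ℂ)
    (hk : k ∈ principalLevelSubgroup δ N)
    (Λ₁ : φ₁.SymplecticLift s₁ Θ₁ δ) (m₁ : SiegelAdelicMarking J a (A₁.fibre s₁).toAbelianVariety)
    (hΛ₁ : ∀ ⦃M : ℕ⦄, N ∣ M → M ≠ 0 → ∀ (x : Fin g ⊕ Fin g → ZMod M) (v : Fin g ⊕ Fin g → ℚ),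
      AdelicCongr ((a⁻¹ : gspFinAdelic δ) : GL (Fin g ⊕ Fin g) finAdeleQ) 1 v (fun i => ((x i).val : ℚ) / M) →
        ((Λ₁.lift M (Multiplicative.ofAdd x)) : (A₁.fibre s₁).toAbelianVariety.Points ℂ) = m₁.r v)
    (Λ₂ : φ₂.SymplecticLift s₂ Θ₂ δ) (m₂ : SiegelAdelicMarking J' a' (A₂.fibre s₂).toAbelianVariety)
    (hΛ₂ : ∀ ⦃M : ℕ⦄, N ∣ M → M ≠ 0 → ∀ (x : Fin g ⊕ Fin g → ZMod M) (v : Fin g ⊕ Fin g → ℚ),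
      AdelicCongr ((a'⁻¹ : gspFinAdelic δ) : GL (Fin g ⊕ Fin g) finAdeleQ) 1 v (fun i => ((x i).val : ℚ) / M) →
        ((Λ₂.lift M (Multiplicative.ofAdd x)) : (A₂.fibre s₂).toAbelianVariety.Points ℂ) = m₂.r v)
    {Bσ : AbelianVariety ℂ} (jσ : Bσ ≅ ((A₁.fibre s₁).toAbelianVariety).conjugate σ.toRingEquiv)
    (Θσ : CartierDivisor Bσ.X.left)
    (hpair : ∀ ⦃M : ℕ⦄, N ∣ M → ∀ (hM : (M : ℂ) ≠ 0),
      haveI := isDominant_toSchemeHom_zsmul_of_ne_zero Bσ hM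
      haveI := isDominant_toSchemeHom_zsmul_of_ne_zero (A₁.fibre s₁).toAbelianVariety hM
      ∀ (P Q : ((A₁.fibre s₁).toAbelianVariety).torsionPoints ℂ M) (Pt Qt : Bσ.torsionPoints ℂ M),
        AlgPoints.map jσ.hom.hom.hom.hom Pt.1 =
          ((A₁.fibre s₁).toAbelianVariety).conjPoints σ.toRingEquiv P.1 →
        AlgPoints.map jσ.hom.hom.hom.hom Qt.1 =
          ((A₁.fibre s₁).toAbelianVariety).conjPoints σ.toRingEquiv Q.1 →
        Bσ.weilPairingLevel Θσ Pt Qt = σ (((A₁.fibre s₁).toAbelianVariety).weilPairingLevel Θ₁ P Q))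
    (f_B : ((A₁.fibre s₁).toAbelianVariety).conjugate σ.toRingEquiv ⟶ (A₂.fibre s₂).toAbelianVariety)
    (hf : ∀ v w : Fin g ⊕ Fin g → ℚ,
      AdelicCongr ((k * a⁻¹ : gspFinAdelic δ) : GL (Fin g ⊕ Fin g) finAdeleQ)
          ((a'⁻¹ : gspFinAdelic δ) : GL (Fin g ⊕ Fin g) finAdeleQ) v w →
        AlgPoints.map f_B.hom.hom.hom
          (((A₁.fibre s₁).toAbelianVariety).conjPoints σ.toRingEquiv (m₁.r v)) = m₂.r w)
    (h : Bσ ≅ (A₂.fibre s₂).toAbelianVariety) (hh : h.hom = jσ.hom ≫ f_B)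
    ⦃M : ℕ⦄ (hNM : N ∣ M) (hM : (M : ℂ) ≠ 0) :
    haveI := isDominant_toSchemeHom_zsmul_of_ne_zero Bσ hM
    haveI := isDominant_toSchemeHom_iso_hom h
    ∃ b : ℤ, IsCoprime b (M : ℤ) ∧ ∀ P Q : Bσ.torsionPoints ℂ M,
      Bσ.weilPairingLevel Θσ P Q =
        Bσ.weilPairingLevel (Θ₂.pullback (AbelianVariety.Hom.toSchemeHom h.hom)) P Q ^ b := by
  haveI hdσ := isDominant_toSchemeHom_zsmul_of_ne_zero Bσ hM
  haveI := isDominant_toSchemeHom_iso_hom h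
  obtain ⟨c, hc, hcPQ⟩ := exists_isCoprime_weilPairingLevel_pullback_eq_zpow_rebase hN σ hk Λ₁ m₁ hΛ₁ Λ₂ m₂ hΛ₂ jσ Θσ
    hpair f_B hf h hh hNM hM
  obtain ⟨b, hb, hbx⟩ := exists_isCoprime_forall_eq_zpow_zpow (K := ℂ) hc
  refine ⟨b, hb, fun P Q => ?_⟩
  rw [hcPQ P Q]
  exact hbx _ (Bσ.weilPairingLevel_ne_zero Θσ P Q) (Bσ.weilPairingLevel_pow_card_eq_one Θσ P Q)

end SiegelAdelicMarking

end Literature.AlgebraicGeometry.ModuliOfAbelianVarieties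

end
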